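import Literature.Analysis.FluidPDE.AxisymShellLadyzhenskaya
import HarnessLib

/-!
# Even moments of axially symmetric functions supported off the axis (two-dimensional Sobolev)

Analysis/FluidPDE support file (everything proved; no definitions, no named facts) on the
decomposition path of the named fact `SereginZajaczkowski2007.OffAxisPoloidalBound`
(G. Seregin, W. Zajaczkowski, SIAM J. Math. Anal. 39 (2007) 669–685 = arXiv:math/0702720,
Lemma 4.2). The last step of the printed proof of that lemma reads: "According to (4.6) and
(4.7), one may conclude `∫_{-2}^{2} ∫_{1/4}^{3} |∇_a Ṽ|² dϱ dx₃ ≤ c ∫∫ (|χ̃|² + |V^a|²) dϱ dx₃ ≤ Φ₃(𝒜₂)`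
and thus `∫_{-2}^{2} ∫_{1/4}^{3} |Ṽ(x, t)|^q dϱ dx₃ ≤ Φ₄(q, 𝒜₂)` for all `t ∈ ]-2², 0[`" (arXiv
p. 6), i.e. the TWO-dimensional Sobolev embedding `H¹(ℝ²) ⊂ L^q(ℝ²)`, `q < ∞`, applied in the
variables `(ϱ, x₃)` to compactly supported functions living on the shell
`𝒞̃ = {1/4 < |x'| < 3, |x₃| < 2}`, where `dx = ϱ dϱ dφ dx₃` is comparable with `dϱ dφ dx₃`.

This file proves that embedding for all EVEN exponents `2m`, in the multiplicative form produced
by the Gagliardo–Nirenberg–Sobolev inequality, for axially symmetric scalars on `ℝ³` supported in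
a shell `{ϱ₀ ≤ |x'| ≤ ϱ₁}`, `ϱ₀ > 0`:

`exists_axisym_even_moment_const`: for `0 < ϱ₀ ≤ ϱ₁` and `m ≥ 1` there is `C ≥ 0` with
`∫ f^{2m} dx ≤ C (∫ f² dx) (∫ ‖Df‖² dx)^{m-1}`
for every `C¹` compactly supported axially symmetric `f : ℝ³ → ℝ` vanishing outside
`{ϱ₀ ≤ |x'| ≤ ϱ₁}` (the case `m = 2` is the Ladyzhenskaya inequality of
`AxisymShellLadyzhenskaya`). Intermediate real exponents `2 ≤ q ≤ 2m` follow pointwise from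
`|f|^q ≤ f² + f^{2m}`; they are left to the consumer.

## Proof

Planar step (`ℝ × ℝ`, Lebesgue measure): Mathlib's Gagliardo–Nirenberg–Sobolev inequality with
`p = 1` in dimension two, `‖w‖_{L²} ≤ C_GNS ‖Dw‖_{L¹}` (`integral_sq_le_planar`, real form of
`MeasureTheory.lintegral_pow_le_pow_lintegral_fderiv`), applied to `w = g^{m+1}`:
`‖D(g^{m+1})‖ = (m+1) |g|^m ‖Dg‖`, so by Cauchy–Schwarz
`∫ g^{2m+2} ≤ C_GNS (m+1)² (∫ g^{2m}) (∫ ‖Dg‖²)` (`integral_pow_succ_le_planar`), and induction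
from `m = 1` gives `∫ g^{2m} ≤ K_m (∫ g²)(∫ ‖Dg‖²)^{m-1}` (`exists_planar_even_moment_const`).
Transfer to `ℝ³`: as in `AxisymShellLadyzhenskaya` through the meridian profile
`g = f ∘ meridianPoint` and the radial reduction against the weight `ϱ⁻¹` (accepted
`IsAxisymmetricScalar.integral_mul_inv_cylRadius_eq`), packaged here as the two-sided
comparison `integral_le_mul_integral_profile`, `integral_profile_le_mul_integral` between
`∫_{ℝ³} X dx` and `∫_{ℝ×ℝ} X ∘ meridianPoint` for nonnegative axisymmetric `X` supported in the
shell, together with `‖Dg‖ ≤ 2 ‖Df ∘ meridianPoint‖` (accepted `norm_fderiv_comp_meridianPoint_le`).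

## References

* G. Seregin, W. Zajaczkowski, SIAM J. Math. Anal. 39 (2007) 669–685, arXiv:math/0702720, proof
  of Lemma 4.2, last display (arXiv p. 6). [`SereginZajaczkowski2007`]
* Mathlib, `Mathlib.Analysis.FunctionalSpaces.SobolevInequality` (Gagliardo–Nirenberg–Sobolev).
-/

noncomputable section

open MeasureTheory Set Function Filter Topology TopologicalSpace WithLp Metric
open scoped RealInnerProductSpace ENNReal NNReal

namespace Literature.Analysis.FluidPDE

/-! ### Planar: the Sobolev inequality `‖w‖₂ ≤ C ‖Dw‖₁` in real form and the moment recursion -/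

/-- **Gagliardo–Nirenberg–Sobolev on `ℝ × ℝ` in real form**: for a compactly supported `C¹`
function `w`, `∫ w² ≤ C_GNS (∫ ‖Dw‖)²`, `C_GNS = lintegralPowLePowLIntegralFDerivConst volume 2`
(Mathlib's `lintegral_pow_le_pow_lintegral_fderiv` with `p = 1`, `p* = 2` in dimension two,
rewritten for Bochner integrals of continuous compactly supported integrands). [folklore] -/
theorem integral_sq_le_planar {w : ℝ × ℝ → ℝ} (hw : ContDiff ℝ 1 w) (hwc : HasCompactSupport w) :
    ∫ q, w q ^ 2 ≤ (lintegralPowLePowLIntegralFDerivConst (volume : Measure (ℝ × ℝ)) 2 : ℝ) *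
      (∫ q, ‖fderiv ℝ w q‖) ^ 2 := by
  haveI : (volume : Measure (ℝ × ℝ)).IsAddHaarMeasure := by
    rw [Measure.volume_eq_prod]
    infer_instance
  have hwcont : Continuous w := hw.continuous
  have hDwcont : Continuous fun q => fderiv ℝ w q := hw.continuous_fderiv one_ne_zero
  have hwc2 : HasCompactSupport fun q => w q ^ 2 :=
    hwc.comp_left (g := fun v : ℝ => v ^ 2) (by simp)
  have hwcD : HasCompactSupport fun q => ‖fderiv ℝ w q‖ :=
    (hwc.fderiv ℝ).comp_left (g := fun A : ℝ × ℝ →L[ℝ] ℝ => ‖A‖) (by simp)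
  have h2i : Integrable fun q => w q ^ 2 := (hwcont.pow 2).integrable_of_hasCompactSupport hwc2
  have hDi : Integrable fun q => ‖fderiv ℝ w q‖ :=
    hDwcont.norm.integrable_of_hasCompactSupport hwcD
  have hE : Module.finrank ℝ (ℝ × ℝ) = 2 := by
    rw [Module.finrank_prod, Module.finrank_self]
  have hp : (Module.finrank ℝ (ℝ × ℝ) : ℝ).HolderConjugate 2 := by
    rw [hE, Nat.cast_ofNat]
    exact Real.HolderConjugate.two_two
  have hGNS := lintegral_pow_le_pow_lintegral_fderiv (volume : Measure (ℝ × ℝ)) hw hwc hp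
  have e2 : ∫⁻ q, ‖w q‖ₑ ^ (2 : ℝ) = ENNReal.ofReal (∫ q, w q ^ 2) := by
    rw [← lintegral_ofReal_eq_ofReal_integral h2i fun q => by positivity]
    refine lintegral_congr fun q => ?_
    rw [ENNReal.rpow_two, Real.enorm_eq_ofReal_abs, ← ENNReal.ofReal_pow (abs_nonneg _), sq_abs]
  have eD : ∫⁻ q, ‖fderiv ℝ w q‖ₑ = ENNReal.ofReal (∫ q, ‖fderiv ℝ w q‖) := by
    rw [← lintegral_ofReal_eq_ofReal_integral hDi fun q => by positivity]
    refine lintegral_congr fun q => ?_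
    rw [ofReal_norm]
  have hID : 0 ≤ ∫ q, ‖fderiv ℝ w q‖ := integral_nonneg fun q => by positivity
  rw [e2, eD, ENNReal.rpow_two, ← ENNReal.ofReal_pow hID, ← ENNReal.ofReal_coe_nnreal,
    ← ENNReal.ofReal_mul (by positivity)] at hGNS
  exact (ENNReal.ofReal_le_ofReal_iff (by positivity)).1 hGNS

/-- The derivative of a power: `‖D(g^{m+1})(q)‖ = (m+1) |g(q)|^m ‖Dg(q)‖`. [folklore] -/
theorem norm_fderiv_pow_succ {g : ℝ × ℝ → ℝ} (hg : Differentiable ℝ g) (m : ℕ) (q : ℝ × ℝ) :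
    ‖fderiv ℝ (fun q => g q ^ (m + 1)) q‖ = ((m : ℝ) + 1) * |g q| ^ m * ‖fderiv ℝ g q‖ := by
  rw [((hg q).hasFDerivAt.pow (m + 1)).fderiv, norm_smul, Nat.add_sub_cancel, nsmul_eq_mul,
    Real.norm_eq_abs, abs_mul, abs_pow, Nat.cast_add, Nat.cast_one]
  congr 2
  exact abs_of_nonneg (by positivity)

/-- `(|a|^m)² = a^{2m}`. [folklore] -/
theorem abs_pow_sq_eq (a : ℝ) (m : ℕ) : (|a| ^ m) ^ 2 = a ^ (2 * m) := by
  rw [← abs_pow, sq_abs]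
  ring

/-- **The moment recursion on `ℝ × ℝ`**: for a compactly supported `C¹` function `g` and `m ≥ 1`,
`∫ g^{2m+2} ≤ C_GNS (m+1)² (∫ g^{2m}) (∫ ‖Dg‖²)` (the planar Sobolev inequality for `w = g^{m+1}`,
whose derivative is `(m+1) g^m Dg`, and Cauchy–Schwarz). [folklore] -/
theorem integral_pow_succ_le_planar {g : ℝ × ℝ → ℝ} (hg : ContDiff ℝ 1 g)
    (hgc : HasCompactSupport g) {m : ℕ} (hm : 1 ≤ m) :
    ∫ q, g q ^ (2 * (m + 1)) ≤
      (lintegralPowLePowLIntegralFDerivConst (volume : Measure (ℝ × ℝ)) 2 : ℝ) * ((m : ℝ) + 1) ^ 2 *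
        (∫ q, g q ^ (2 * m)) * ∫ q, ‖fderiv ℝ g q‖ ^ 2 := by
  set CG : ℝ := (lintegralPowLePowLIntegralFDerivConst (volume : Measure (ℝ × ℝ)) 2 : ℝ) with hCG
  have hCG0 : 0 ≤ CG := by positivity
  have hm0 : m ≠ 0 := by omega
  have hgd : Differentiable ℝ g := hg.differentiable one_ne_zero
  have hgcont : Continuous g := hg.continuous
  have hDgcont : Continuous fun q => fderiv ℝ g q := hg.continuous_fderiv one_ne_zero
  -- `w = g^{m+1}`
  set w : ℝ × ℝ → ℝ := fun q => g q ^ (m + 1) with hw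
  have hw1 : ContDiff ℝ 1 w := hg.pow (m + 1)
  have hwc : HasCompactSupport w := hgc.comp_left (g := fun v : ℝ => v ^ (m + 1)) (by simp)
  have hS := integral_sq_le_planar hw1 hwc
  -- `∫ w² = ∫ g^{2m+2}`
  have e1 : ∫ q, w q ^ 2 = ∫ q, g q ^ (2 * (m + 1)) := by
    refine integral_congr_ae (Eventually.of_forall fun q => ?_)
    simp only [hw]
    ring
  -- `∫ ‖Dw‖ = (m+1) ∫ |g|^m ‖Dg‖`
  have e2 : ∫ q, ‖fderiv ℝ w q‖ = ((m : ℝ) + 1) * ∫ q, |g q| ^ m * ‖fderiv ℝ g q‖ := by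
    rw [← integral_const_mul]
    refine integral_congr_ae (Eventually.of_forall fun q => ?_)
    dsimp only
    rw [hw, norm_fderiv_pow_succ hgd m q]
    ring
  -- Cauchy–Schwarz: `(∫ |g|^m ‖Dg‖)² ≤ (∫ g^{2m}) (∫ ‖Dg‖²)`
  have hc1 : HasCompactSupport fun q => |g q| ^ m :=
    hgc.comp_left (g := fun v : ℝ => |v| ^ m) (by simp [hm0])
  have hc2 : HasCompactSupport fun q => ‖fderiv ℝ g q‖ :=
    (hgc.fderiv ℝ).comp_left (g := fun A : ℝ × ℝ →L[ℝ] ℝ => ‖A‖) (by simp)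
  have hm1 : Continuous fun q => |g q| ^ m := (continuous_abs.comp hgcont).pow m
  have hm2 : Continuous fun q => ‖fderiv ℝ g q‖ := hDgcont.norm
  have hp1 : MemLp (fun q => |g q| ^ m) (ENNReal.ofReal 2) (volume : Measure (ℝ × ℝ)) :=
    hm1.memLp_of_hasCompactSupport hc1
  have hp2 : MemLp (fun q => ‖fderiv ℝ g q‖) (ENNReal.ofReal 2) (volume : Measure (ℝ × ℝ)) :=
    hm2.memLp_of_hasCompactSupport hc2
  have hH := integral_mul_le_Lp_mul_Lq_of_nonneg (μ := (volume : Measure (ℝ × ℝ)))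
    Real.HolderConjugate.two_two
    (Eventually.of_forall fun q => by simp only [Pi.zero_apply]; positivity)
    (Eventually.of_forall fun q => by simp only [Pi.zero_apply]; positivity) hp1 hp2
  have eX : ∫ q, (|g q| ^ m) ^ (2 : ℝ) = ∫ q, g q ^ (2 * m) := by
    refine integral_congr_ae (Eventually.of_forall fun q => ?_)
    dsimp only
    rw [Real.rpow_two, abs_pow_sq_eq]
  have eY : ∫ q : ℝ × ℝ, ‖fderiv ℝ g q‖ ^ (2 : ℝ) = ∫ q, ‖fderiv ℝ g q‖ ^ 2 := by
    refine integral_congr_ae (Eventually.of_forall fun q => ?_)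
    dsimp only
    rw [Real.rpow_two]
  have hX0 : 0 ≤ ∫ q, g q ^ (2 * m) := integral_nonneg fun q => by
    simp only [Pi.zero_apply]
    rw [pow_mul]
    positivity
  have hY0 : 0 ≤ ∫ q, ‖fderiv ℝ g q‖ ^ 2 := integral_nonneg fun q => by positivity
  have hA0 : 0 ≤ ∫ q, |g q| ^ m * ‖fderiv ℝ g q‖ := integral_nonneg fun q => by positivity
  rw [eX, eY, show (1 / 2 : ℝ) = 1 / 2 from rfl, ← Real.sqrt_eq_rpow, ← Real.sqrt_eq_rpow] at hH
  have hsq : (∫ q, |g q| ^ m * ‖fderiv ℝ g q‖) ^ 2 ≤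
      (∫ q, g q ^ (2 * m)) * ∫ q, ‖fderiv ℝ g q‖ ^ 2 := by
    calc (∫ q, |g q| ^ m * ‖fderiv ℝ g q‖) ^ 2
        ≤ (Real.sqrt (∫ q, g q ^ (2 * m)) * Real.sqrt (∫ q, ‖fderiv ℝ g q‖ ^ 2)) ^ 2 :=
          pow_le_pow_left₀ hA0 hH 2
      _ = (∫ q, g q ^ (2 * m)) * ∫ q, ‖fderiv ℝ g q‖ ^ 2 := by
          rw [mul_pow, Real.sq_sqrt hX0, Real.sq_sqrt hY0]
  -- assembling
  calc ∫ q, g q ^ (2 * (m + 1)) = ∫ q, w q ^ 2 := e1.symm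
    _ ≤ CG * (∫ q, ‖fderiv ℝ w q‖) ^ 2 := hS
    _ = CG * ((m : ℝ) + 1) ^ 2 * (∫ q, |g q| ^ m * ‖fderiv ℝ g q‖) ^ 2 := by rw [e2]; ring
    _ ≤ CG * ((m : ℝ) + 1) ^ 2 * ((∫ q, g q ^ (2 * m)) * ∫ q, ‖fderiv ℝ g q‖ ^ 2) := by
        gcongr
    _ = CG * ((m : ℝ) + 1) ^ 2 * (∫ q, g q ^ (2 * m)) * ∫ q, ‖fderiv ℝ g q‖ ^ 2 := by ring

/-- **Even moments on `ℝ × ℝ`** (two-dimensional Sobolev embedding `H¹ ⊂ L^{2m}` in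
multiplicative form): for every `m ≥ 1` there is `K ≥ 0` with
`∫ g^{2m} ≤ K (∫ g²) (∫ ‖Dg‖²)^{m-1}` for all compactly supported `C¹` functions `g`
(induction on `m` from the moment recursion). [folklore] -/
theorem exists_planar_even_moment_const (m : ℕ) (hm : 1 ≤ m) :
    ∃ K : ℝ, 0 ≤ K ∧ ∀ g : ℝ × ℝ → ℝ, ContDiff ℝ 1 g → HasCompactSupport g →
      ∫ q, g q ^ (2 * m) ≤ K * (∫ q, g q ^ 2) * (∫ q, ‖fderiv ℝ g q‖ ^ 2) ^ (m - 1) := by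
  induction m, hm using Nat.le_induction with
  | base =>
      refine ⟨1, zero_le_one, fun g _ _ => ?_⟩
      simp
  | succ m hm ih =>
      obtain ⟨K, hK0, hK⟩ := ih
      set CG : ℝ := (lintegralPowLePowLIntegralFDerivConst (volume : Measure (ℝ × ℝ)) 2 : ℝ)
        with hCG
      refine ⟨CG * ((m : ℝ) + 1) ^ 2 * K, by positivity, fun g hg hgc => ?_⟩
      have h1 := integral_pow_succ_le_planar hg hgc hm
      have h2 := hK g hg hgc
      have hY0 : 0 ≤ ∫ q, ‖fderiv ℝ g q‖ ^ 2 := integral_nonneg fun q => by positivity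
      obtain ⟨k, rfl⟩ : ∃ k, m = k + 1 := ⟨m - 1, by omega⟩
      rw [Nat.add_sub_cancel] at h2
      rw [Nat.add_sub_cancel]
      calc ∫ q, g q ^ (2 * (k + 1 + 1))
          ≤ CG * (((k + 1 : ℕ) : ℝ) + 1) ^ 2 * (∫ q, g q ^ (2 * (k + 1))) *
              ∫ q, ‖fderiv ℝ g q‖ ^ 2 := h1
        _ ≤ CG * (((k + 1 : ℕ) : ℝ) + 1) ^ 2 *
              (K * (∫ q, g q ^ 2) * (∫ q, ‖fderiv ℝ g q‖ ^ 2) ^ k) *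
              ∫ q, ‖fderiv ℝ g q‖ ^ 2 := by gcongr
        _ = CG * (((k + 1 : ℕ) : ℝ) + 1) ^ 2 * K * (∫ q, g q ^ 2) *
              (∫ q, ‖fderiv ℝ g q‖ ^ 2) ^ (k + 1) := by ring

/-! ### Transfer to `ℝ³`: comparison of `∫ X dx` with the planar integral of the profile -/

/-- **Upper comparison**: for a continuous compactly supported axisymmetric `X ≥ 0` on `ℝ³`
vanishing where `|x'| < ϱ₀` or `ϱ₁ < |x'|` (`ϱ₀ > 0`),
`∫ X dx ≤ ϱ₁ (c₂/2) ∫_{ℝ×ℝ} X ∘ meridianPoint` (`dx = ϱ dϱ dφ dz` with `ϱ ≤ ϱ₁`). [folklore] -/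
theorem integral_le_mul_integral_profile {X : EuclideanSpace ℝ (Fin 3) → ℝ} {ρ₀ ρ₁ : ℝ}
    (h0 : 0 < ρ₀) (hXa : IsAxisymmetricScalar X) (hXm : Continuous X) (hXc : HasCompactSupport X)
    (hX0 : ∀ x, 0 ≤ X x) (hsupp : ∀ x, X x ≠ 0 → ρ₀ ≤ cylRadius x ∧ cylRadius x ≤ ρ₁) :
    ∫ x, X x ≤ ρ₁ * (radialConst₂ / 2) * ∫ q : ℝ × ℝ, X (meridianPoint q) := by
  have hXi : Integrable X := hXm.integrable_of_hasCompactSupport hXc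
  have hmPc : Continuous meridianPoint := (contDiff_meridianPoint (n := 1)).continuous
  have hPc : HasCompactSupport fun q : ℝ × ℝ => X (meridianPoint q) :=
    hasCompactSupport_comp_meridianPoint (X := X) hXc
  have hPi : Integrable fun q : ℝ × ℝ => X (meridianPoint q) :=
    (Continuous.comp (g := X) hXm hmPc).integrable_of_hasCompactSupport hPc
  have r := hXa.integral_mul_inv_cylRadius_eq
    (integrable_mul_inv_cylRadius h0 hXi fun x hx => (hsupp x hx).1) hPi
  have c := integral_le_mul_integral_mul_inv_cylRadius h0 hXi hX0 hsupp
  rw [r] at c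
  linarith [c]

/-- **Lower comparison**: for a continuous compactly supported axisymmetric `X ≥ 0` on `ℝ³`
vanishing where `|x'| < ϱ₀` (`ϱ₀ > 0`), `∫_{ℝ×ℝ} X ∘ meridianPoint ≤ (2/(c₂ ϱ₀)) ∫ X dx`
(`dx = ϱ dϱ dφ dz` with `ϱ₀ ≤ ϱ`). [folklore] -/
theorem integral_profile_le_mul_integral {X : EuclideanSpace ℝ (Fin 3) → ℝ} {ρ₀ : ℝ}
    (h0 : 0 < ρ₀) (hXa : IsAxisymmetricScalar X) (hXm : Continuous X) (hXc : HasCompactSupport X)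
    (hX0 : ∀ x, 0 ≤ X x) (hsupp : ∀ x, X x ≠ 0 → ρ₀ ≤ cylRadius x) :
    ∫ q : ℝ × ℝ, X (meridianPoint q) ≤ 2 / (radialConst₂ * ρ₀) * ∫ x, X x := by
  have hc2 : 0 < radialConst₂ := radialConst₂_pos
  have hXi : Integrable X := hXm.integrable_of_hasCompactSupport hXc
  have hmPc : Continuous meridianPoint := (contDiff_meridianPoint (n := 1)).continuous
  have hPc : HasCompactSupport fun q : ℝ × ℝ => X (meridianPoint q) :=
    hasCompactSupport_comp_meridianPoint (X := X) hXc
  have hPi : Integrable fun q : ℝ × ℝ => X (meridianPoint q) :=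
    (Continuous.comp (g := X) hXm hmPc).integrable_of_hasCompactSupport hPc
  have r := hXa.integral_mul_inv_cylRadius_eq (integrable_mul_inv_cylRadius h0 hXi hsupp) hPi
  have c := mul_integral_mul_inv_cylRadius_le h0 hXi hX0 hsupp
  rw [r] at c
  have : ∫ q : ℝ × ℝ, X (meridianPoint q) =
      2 / (radialConst₂ * ρ₀) * (ρ₀ * (radialConst₂ / 2 * ∫ q : ℝ × ℝ, X (meridianPoint q))) := by
    field_simp
  rw [this]
  exact mul_le_mul_of_nonneg_left c (by positivity)

/-! ### The even moments on `ℝ³` -/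

/-- **Even moments of axially symmetric functions supported off the axis** (the two-dimensional
Sobolev embedding in the variables `(ϱ, x₃)` behind the last display of the proof of
Seregin–Zajaczkowski 2007, Lemma 4.2: "and thus `∫∫ |Ṽ(x,t)|^q dϱ dx₃ ≤ Φ₄(q, 𝒜₂)`"). For
`0 < ϱ₀ ≤ ϱ₁` and `m ≥ 1` there is a constant `C ≥ 0` such that every `C¹` compactly supported
axially symmetric scalar `f : ℝ³ → ℝ` vanishing outside `{ϱ₀ ≤ |x'| ≤ ϱ₁}` satisfies
`∫ f^{2m} dx ≤ C (∫ f² dx) (∫ ‖Df‖² dx)^{m-1}`. Proof: module docstring.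
[cite: SereginZajaczkowski2007, proof of Lemma 4.2, last display (arXiv p. 6)] -/
theorem exists_axisym_even_moment_const {ρ₀ ρ₁ : ℝ} (h0 : 0 < ρ₀) (h01 : ρ₀ ≤ ρ₁) (m : ℕ)
    (hm : 1 ≤ m) :
    ∃ C : ℝ, 0 ≤ C ∧ ∀ f : EuclideanSpace ℝ (Fin 3) → ℝ, ContDiff ℝ 1 f → HasCompactSupport f →
      IsAxisymmetricScalar f → (∀ x, f x ≠ 0 → ρ₀ ≤ cylRadius x ∧ cylRadius x ≤ ρ₁) →
        ∫ x, f x ^ (2 * m) ≤ C * (∫ x, f x ^ 2) * (∫ x, ‖fderiv ℝ f x‖ ^ 2) ^ (m - 1) := by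
  obtain ⟨K, hK0, hK⟩ := exists_planar_even_moment_const m hm
  have hc2 : 0 < radialConst₂ := radialConst₂_pos
  have hρ₁ : 0 ≤ ρ₁ := h0.le.trans h01
  have hm0 : m ≠ 0 := by omega
  refine ⟨ρ₁ * (radialConst₂ / 2) * K * (2 / (radialConst₂ * ρ₀)) *
    (8 / (radialConst₂ * ρ₀)) ^ (m - 1), by positivity, ?_⟩
  intro f hf hfc hfa hsupp
  have hfd : Differentiable ℝ f := hf.differentiable one_ne_zero
  have hfcont : Continuous f := hf.continuous
  have hDcont : Continuous fun x => fderiv ℝ f x := hf.continuous_fderiv one_ne_zero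
  have hDc : HasCompactSupport fun x => fderiv ℝ f x := hfc.fderiv ℝ
  -- support of `Df`
  have hclosed : IsClosed {x : EuclideanSpace ℝ (Fin 3) | ρ₀ ≤ cylRadius x ∧ cylRadius x ≤ ρ₁} := by
    have : {x : EuclideanSpace ℝ (Fin 3) | ρ₀ ≤ cylRadius x ∧ cylRadius x ≤ ρ₁} =
        cylRadius ⁻¹' Icc ρ₀ ρ₁ := rfl
    rw [this]
    exact isClosed_Icc.preimage continuous_cylRadius
  have htsupp : tsupport f ⊆ {x : EuclideanSpace ℝ (Fin 3) | ρ₀ ≤ cylRadius x ∧ cylRadius x ≤ ρ₁} :=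
    closure_minimal (fun x hx => hsupp x hx) hclosed
  have hsuppD : ∀ x, fderiv ℝ f x ≠ 0 → ρ₀ ≤ cylRadius x ∧ cylRadius x ≤ ρ₁ := fun x hx =>
    htsupp (tsupport_fderiv_subset ℝ (subset_tsupport _ hx))
  -- the three integrands on `ℝ³`
  set XM : EuclideanSpace ℝ (Fin 3) → ℝ := fun x => f x ^ (2 * m) with hXM
  set X2 : EuclideanSpace ℝ (Fin 3) → ℝ := fun x => f x ^ 2 with hX2
  set XD : EuclideanSpace ℝ (Fin 3) → ℝ := fun x => ‖fderiv ℝ f x‖ ^ 2 with hXD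
  have hXMa : IsAxisymmetricScalar XM := fun θ x => by simp only [hXM, hfa θ x]
  have hX2a : IsAxisymmetricScalar X2 := fun θ x => by simp only [hX2, hfa θ x]
  have hXDa : IsAxisymmetricScalar XD := fun θ x => by
    simp only [hXD, hfa.norm_fderiv hfd θ x]
  have hXMc : HasCompactSupport XM :=
    hfc.comp_left (g := fun v : ℝ => v ^ (2 * m)) (by simp [hm0])
  have hX2c : HasCompactSupport X2 := hfc.comp_left (g := fun v : ℝ => v ^ 2) (by simp)
  have hXDc : HasCompactSupport XD :=
    hDc.comp_left (g := fun A : EuclideanSpace ℝ (Fin 3) →L[ℝ] ℝ => ‖A‖ ^ 2) (by simp)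
  have hXMm : Continuous XM := hfcont.pow (2 * m)
  have hX2m : Continuous X2 := hfcont.pow 2
  have hXDm : Continuous XD := hDcont.norm.pow 2
  have hXMs : ∀ x, XM x ≠ 0 → ρ₀ ≤ cylRadius x ∧ cylRadius x ≤ ρ₁ := fun x hx =>
    hsupp x fun h => hx (by simp [hXM, h, hm0])
  have hX2s : ∀ x, X2 x ≠ 0 → ρ₀ ≤ cylRadius x := fun x hx =>
    (hsupp x fun h => hx (by simp [hX2, h])).1
  have hXDs : ∀ x, XD x ≠ 0 → ρ₀ ≤ cylRadius x := fun x hx =>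
    (hsuppD x fun h => hx (by simp [hXD, h])).1
  -- the meridian profile
  set g : ℝ × ℝ → ℝ := f ∘ meridianPoint with hg
  have hg1 : ContDiff ℝ 1 g := ContDiff.comp_meridianPoint hf
  have hgc : HasCompactSupport g := hasCompactSupport_comp_meridianPoint hfc
  have hDgcont : Continuous fun q => fderiv ℝ g q := hg1.continuous_fderiv one_ne_zero
  have hmPc : Continuous meridianPoint := (contDiff_meridianPoint (n := 1)).continuous
  have hPDc : HasCompactSupport fun q : ℝ × ℝ => XD (meridianPoint q) :=
    hasCompactSupport_comp_meridianPoint (X := XD) hXDc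
  have hDgc : HasCompactSupport fun q : ℝ × ℝ => ‖fderiv ℝ g q‖ ^ 2 :=
    (hgc.fderiv ℝ).comp_left (g := fun A : ℝ × ℝ →L[ℝ] ℝ => ‖A‖ ^ 2) (by simp)
  have hPDi : Integrable fun q : ℝ × ℝ => XD (meridianPoint q) :=
    (Continuous.comp (g := XD) hXDm hmPc).integrable_of_hasCompactSupport hPDc
  have hDg2i : Integrable fun q : ℝ × ℝ => ‖fderiv ℝ g q‖ ^ 2 :=
    (hDgcont.norm.pow 2).integrable_of_hasCompactSupport hDgc
  -- (1) the planar moment bound for `g`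
  have hplanar : ∫ q : ℝ × ℝ, XM (meridianPoint q) ≤
      K * (∫ q : ℝ × ℝ, X2 (meridianPoint q)) * (∫ q : ℝ × ℝ, ‖fderiv ℝ g q‖ ^ 2) ^ (m - 1) :=
    hK g hg1 hgc
  -- (2) `∫ ‖Dg‖² ≤ 4 ∫ ‖Df ∘ meridianPoint‖²`
  have hDg : ∫ q : ℝ × ℝ, ‖fderiv ℝ g q‖ ^ 2 ≤ 4 * ∫ q : ℝ × ℝ, XD (meridianPoint q) := by
    rw [← integral_const_mul]
    refine integral_mono hDg2i (hPDi.const_mul 4) fun q => ?_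
    dsimp only [hXD]
    have h := norm_fderiv_comp_meridianPoint_le hfd q
    have h0' : 0 ≤ ‖fderiv ℝ (f ∘ meridianPoint) q‖ := norm_nonneg _
    nlinarith [h, h0']
  -- (3) the comparisons
  have hXM0 : ∀ x, 0 ≤ XM x := fun x => by
    simp only [hXM]
    rw [pow_mul]
    positivity
  have cM : ∫ x, XM x ≤ ρ₁ * (radialConst₂ / 2) * ∫ q : ℝ × ℝ, XM (meridianPoint q) :=
    integral_le_mul_integral_profile h0 hXMa hXMm hXMc hXM0 hXMs
  have c2 : ∫ q : ℝ × ℝ, X2 (meridianPoint q) ≤ 2 / (radialConst₂ * ρ₀) * ∫ x, X2 x :=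
    integral_profile_le_mul_integral h0 hX2a hX2m hX2c (fun x => by positivity) hX2s
  have cD : ∫ q : ℝ × ℝ, XD (meridianPoint q) ≤ 2 / (radialConst₂ * ρ₀) * ∫ x, XD x :=
    integral_profile_le_mul_integral h0 hXDa hXDm hXDc (fun x => by positivity) hXDs
  have hPD : ∫ q : ℝ × ℝ, ‖fderiv ℝ g q‖ ^ 2 ≤ 8 / (radialConst₂ * ρ₀) * ∫ x, XD x := by
    refine hDg.trans ?_
    have : 8 / (radialConst₂ * ρ₀) * ∫ x, XD x = 4 * (2 / (radialConst₂ * ρ₀) * ∫ x, XD x) := by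
      ring
    rw [this]
    exact mul_le_mul_of_nonneg_left cD (by norm_num)
  have hI2 : 0 ≤ ∫ x, X2 x := integral_nonneg fun x => by positivity
  have hP2' : 0 ≤ ∫ q : ℝ × ℝ, X2 (meridianPoint q) := integral_nonneg fun q => by positivity
  have hPD' : 0 ≤ ∫ q : ℝ × ℝ, ‖fderiv ℝ g q‖ ^ 2 := integral_nonneg fun q => by positivity
  -- (4) assembling
  calc ∫ x, f x ^ (2 * m) = ∫ x, XM x := rfl
    _ ≤ ρ₁ * (radialConst₂ / 2) * ∫ q : ℝ × ℝ, XM (meridianPoint q) := cM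
    _ ≤ ρ₁ * (radialConst₂ / 2) *
        (K * (∫ q : ℝ × ℝ, X2 (meridianPoint q)) * (∫ q : ℝ × ℝ, ‖fderiv ℝ g q‖ ^ 2) ^ (m - 1)) := by
        gcongr
    _ ≤ ρ₁ * (radialConst₂ / 2) *
        (K * (2 / (radialConst₂ * ρ₀) * ∫ x, X2 x) *
          (8 / (radialConst₂ * ρ₀) * ∫ x, XD x) ^ (m - 1)) := by
        gcongr
    _ = ρ₁ * (radialConst₂ / 2) * K * (2 / (radialConst₂ * ρ₀)) *
        (8 / (radialConst₂ * ρ₀)) ^ (m - 1) * (∫ x, f x ^ 2) *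
          (∫ x, ‖fderiv ℝ f x‖ ^ 2) ^ (m - 1) := by
        simp only [hX2, hXD]
        rw [mul_pow]
        ring

end Literature.Analysis.FluidPDE
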